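import Summits.KontsevichZagierPeriods.Zeta5Search.DescentPhatDenominatorsBox
import Summits.KontsevichZagierPeriods.Zeta5Search.SymmetricPhatXSave
import HarnessLib

/-!
# Brown–Zudilin's RECORD ray `a = (8,16,10,15,12,16,18,13)·n`: the data of the descent (22) and a Kummer lemma
(cell `pub-zeta5`, seat ct-1 g46)

HONEST FRAMING: systematic search; no irrationality claim unless certified.  Bookkeeping (linear forms in `n`) for the ray of
Brown–Zudilin's Theorem 1 (arXiv:2210.03391, Sect. 11: worthiness `0.86597135…`, a MODEL number conditional on (28); NOTHING
about it is touched here); no `γ` / record statement; records in print UNMOVED; net named-fact debt 0.  Theorems only (0 `def`;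
the ray is written `n • ![8,16,10,15,12,16,18,13]` throughout).

OUR work (Summit side), the input of `RecordRayPhatDenominators`:
* `smul_rec`, `pOf_rec` (`p = (15,14,16,29,18,13,12)·n`), `qOf_rec` (`q = (15,12,10,8,16)·n`), `bOfA_rec_zero/_pos`
  (`b = (41; 17,16,15,14,13,12,11)·n`, i.e. `b_i = (18−i)n`), `dOf_rec` (`d = 25n`), `m1Of_rec` (`m₁ = 18n`), `converges_rec`,
  `inBox_rec` (the nine hypotheses of `rhs22_eq_on_box` for every `n ≥ 1` and every partner `j ∈ [1,7]`);
* the companions of (22): `κ ∈ [18n, 26n]`, Rhin–Viola parameters `(14n, 29n−κ, 16n, 15n, κ−n, κ−2n, κ−3n, 12n)`, integers (2.8)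
  `(κ, 12n, κ−n, 13n, 13n, 15n, 14n, 14n)` (`companion_S_rec`), dominated by `(κ, κ−n, 15n)` (`companion_dom_rec`); weight
  `w_κ = ±C(κ,12n)·C(8n,κ−18n)·C(16n,κ−13n)` (`w22_rec`);
* **`lcmUpto_dvd_lcmUpto_max_mul_choose`** — Kummer's carry in general: `d_κ ∣ d_{max(m,κ−m)}·C(κ,m)` for `m ≤ κ`
  (the diagonal's `SymmetricPhatDenominators.lcmUpto_dvd_lcmUpto_mul_choose` is `m = n ≤ κ ≤ 2n`).
DESK (exact, `alg/record_ray.py`): all of the above checked at `n ≤ 3`.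
-/

noncomputable section

open Finset

namespace Summit.KontsevichZagierPeriods.Zeta5Search.RecordRayDescentData

open Literature.NumberTheory.Irrationality
open Literature.NumberTheory.Irrationality.BrownZudilin2022 (w22 pOf qOf bOfA Converges convergenceForms hList zchoose)
open Literature.NumberTheory.Irrationality.RhinViola2001 (Params)
open Literature.NumberTheory.Irrationality.RhinViola2001.Theorem21 (Dom)
open Summit.KontsevichZagierPeriods.Zeta5Search.WedgeDictionary (dOf)
open Summit.KontsevichZagierPeriods.Zeta5Search.XSave (InRegion m1Of)
open Summit.KontsevichZagierPeriods.Zeta5Search.SymRay (zchoose_natCast)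
open Summit.KontsevichZagierPeriods.Zeta5Search.DescentPhatDenominatorsBox (companion_S)

/-! ### The ray and its descent data -/

/-- `n • (8,16,10,15,12,16,18,13) = (8n,16n,10n,15n,12n,16n,18n,13n)`. -/
theorem smul_rec (n : ℕ) : n • (![8, 16, 10, 15, 12, 16, 18, 13] : Fin 8 → ℤ) =
    ![8 * (n : ℤ), 16 * n, 10 * n, 15 * n, 12 * n, 16 * n, 18 * n, 13 * n] := by
  funext i
  fin_cases i <;> first | (simp; done) | (simp; ring)

/-- `p(n·a) = (15,14,16,29,18,13,12)·n` ((11)). -/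
theorem pOf_rec (n : ℕ) : pOf (n • (![8, 16, 10, 15, 12, 16, 18, 13] : Fin 8 → ℤ)) =
    ![15 * (n : ℤ), 14 * n, 16 * n, 29 * n, 18 * n, 13 * n, 12 * n] := by
  rw [smul_rec]
  funext i
  fin_cases i <;> first | (simp [pOf]; done) | (simp [pOf]; ring)

/-- `q(n·a) = (15,12,10,8,16)·n` ((11)). -/
theorem qOf_rec (n : ℕ) : qOf (n • (![8, 16, 10, 15, 12, 16, 18, 13] : Fin 8 → ℤ)) =
    ![15 * (n : ℤ), 12 * n, 10 * n, 8 * n, 16 * n] := by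
  rw [smul_rec]
  funext i
  fin_cases i <;> first | (simp [qOf]; done) | (simp [qOf]; ring)

/-- `b₀(n·a) = 41n`. -/
theorem bOfA_rec_zero (n : ℕ) : bOfA (n • (![8, 16, 10, 15, 12, 16, 18, 13] : Fin 8 → ℤ)) 0 = 41 * n := by
  rw [smul_rec]; simp [bOfA]; ring

/-- `b_i(n·a) = (18 − i)·n` for `1 ≤ i ≤ 7` (`b = (41; 17,16,15,14,13,12,11)·n`). -/
theorem bOfA_rec_pos (n : ℕ) {i : ℕ} (h1 : 1 ≤ i) (h7 : i ≤ 7) :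
    bOfA (n • (![8, 16, 10, 15, 12, 16, 18, 13] : Fin 8 → ℤ)) i = (18 - (i : ℤ)) * n := by
  rw [smul_rec]
  interval_cases i <;> simp [bOfA] <;> ring

/-- `d(b(n·a)) = 25n`. -/
theorem dOf_rec (n : ℕ) : dOf (bOfA (n • (![8, 16, 10, 15, 12, 16, 18, 13] : Fin 8 → ℤ))) = 25 * n := by
  rw [WedgeDictionary.dOf_bOfA, smul_rec]; simp; ring

/-- `m₁(n·a) = 18n` (the largest of the 28 forms `h_i`). -/
theorem m1Of_rec (n : ℕ) : m1Of (n • (![8, 16, 10, 15, 12, 16, 18, 13] : Fin 8 → ℤ)) = 18 * n := by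
  rw [smul_rec]
  simp only [m1Of, hList, List.foldr, Matrix.cons_val]
  omega

/-- The record integral converges (all seventeen forms (3) are positive multiples of `n`). -/
theorem converges_rec (n : ℕ) : Converges (n • (![8, 16, 10, 15, 12, 16, 18, 13] : Fin 8 → ℤ)) := by
  rw [smul_rec]
  intro x hx
  simp only [convergenceForms, Matrix.cons_val, List.mem_cons, List.not_mem_nil, or_false] at hx
  omega

/-- **The record ray lies in the box of `rhs22_eq_on_box`** for every `n ≥ 1` and every partner `j ∈ [1,7]`:
`InRegion`, `0 ≤ d`, `2b_i ≤ b₀`, `p ≥ 0`, the residue range `p₄+q₄ = 26n ≤ 29n = p₃`, and the closing inequality. -/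
theorem inBox_rec (n : ℕ) (hn : 1 ≤ n) (j : ℕ) (hj : j ∈ Icc 1 7) :
    InRegion (n • (![8, 16, 10, 15, 12, 16, 18, 13] : Fin 8 → ℤ)) j ∧
    (∀ i ∈ Icc 1 7, 2 * bOfA (n • (![8, 16, 10, 15, 12, 16, 18, 13] : Fin 8 → ℤ)) i ≤
        bOfA (n • (![8, 16, 10, 15, 12, 16, 18, 13] : Fin 8 → ℤ)) 0) ∧
    (∀ i, 0 ≤ pOf (n • (![8, 16, 10, 15, 12, 16, 18, 13] : Fin 8 → ℤ)) i) ∧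
    pOf (n • (![8, 16, 10, 15, 12, 16, 18, 13] : Fin 8 → ℤ)) 4 + qOf (n • (![8, 16, 10, 15, 12, 16, 18, 13] : Fin 8 → ℤ)) 3 ≤
      pOf (n • (![8, 16, 10, 15, 12, 16, 18, 13] : Fin 8 → ℤ)) 3 ∧
    bOfA (n • (![8, 16, 10, 15, 12, 16, 18, 13] : Fin 8 → ℤ)) 0 - bOfA (n • (![8, 16, 10, 15, 12, 16, 18, 13] : Fin 8 → ℤ)) 1 -
        bOfA (n • (![8, 16, 10, 15, 12, 16, 18, 13] : Fin 8 → ℤ)) 2 ≤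
      dOf (bOfA (n • (![8, 16, 10, 15, 12, 16, 18, 13] : Fin 8 → ℤ))) +
        max 0 (max (bOfA (n • (![8, 16, 10, 15, 12, 16, 18, 13] : Fin 8 → ℤ)) 7 -
            bOfA (n • (![8, 16, 10, 15, 12, 16, 18, 13] : Fin 8 → ℤ)) 1)
          (bOfA (n • (![8, 16, 10, 15, 12, 16, 18, 13] : Fin 8 → ℤ)) 7 -
            bOfA (n • (![8, 16, 10, 15, 12, 16, 18, 13] : Fin 8 → ℤ)) 2)) := by
  rw [mem_Icc] at hj
  refine ⟨⟨mem_Icc.2 hj, converges_rec n, fun i hi => ?_, ?_, ?_⟩, fun i hi => ?_, ?_, ?_, ?_⟩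
  · rw [mem_Icc] at hi; rw [bOfA_rec_pos n hi.1 hi.2, bOfA_rec_zero]; constructor <;> nlinarith
  · rw [dOf_rec]; omega
  · rw [bOfA_rec_pos n hj.1 hj.2, bOfA_rec_zero]; nlinarith
  · rw [mem_Icc] at hi; rw [bOfA_rec_pos n hi.1 hi.2, bOfA_rec_zero]; nlinarith
  · intro i; rw [pOf_rec]; fin_cases i <;> simp
  · rw [pOf_rec, qOf_rec]; simp; omega
  · rw [dOf_rec, bOfA_rec_zero, bOfA_rec_pos n (i := 1) le_rfl (by norm_num), bOfA_rec_pos n (i := 2) (by norm_num) (by norm_num),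
      bOfA_rec_pos n (i := 7) (by norm_num) le_rfl]
    push_cast
    omega

/-! ### The companions of (22) on the record ray -/

/-- The integers (2.8) of the `κ`-th companion on the record ray: `(κ, 12n, κ−n, 13n, 13n, 15n, 14n, 14n)`. -/
theorem companion_S_rec (n : ℕ) (κ : ℤ) :
    (⟨14 * (n : ℤ), 29 * n - κ, 16 * n, 15 * n, 16 * n + (10 * n - 12 * n + κ) - 15 * n, 10 * n - 12 * n + κ,
        14 * n + (10 * n - 12 * n + κ) - 15 * n, 12 * n⟩ : Params).S =
      [κ, 12 * n, κ - n, 13 * n, 13 * n, 15 * n, 14 * n, 14 * n] := by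
  simp only [Params.S, Params.aux, Params.toList]
  refine List.cons_eq_cons.2 ⟨by ring, List.cons_eq_cons.2 ⟨by ring, List.cons_eq_cons.2 ⟨by ring,
    List.cons_eq_cons.2 ⟨by ring, List.cons_eq_cons.2 ⟨by ring, List.cons_eq_cons.2 ⟨by ring,
    List.cons_eq_cons.2 ⟨by ring, List.cons_eq_cons.2 ⟨by ring, rfl⟩⟩⟩⟩⟩⟩⟩⟩

/-- For `18n ≤ κ` (and `n ≥ 0`) the companion's Rhin–Viola parameters are non-negative when `κ ≤ 29n`, and its (2.8)-list is
dominated by `(M,N,Q) = (κ, κ−n, 15n)`. -/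
theorem companion_dom_rec (n : ℕ) (κ : ℤ) (h1 : 18 * (n : ℤ) ≤ κ) (h2 : κ ≤ 26 * n) :
    (⟨14 * (n : ℤ), 29 * n - κ, 16 * n, 15 * n, 16 * n + (10 * n - 12 * n + κ) - 15 * n, 10 * n - 12 * n + κ,
        14 * n + (10 * n - 12 * n + κ) - 15 * n, 12 * n⟩ : Params).Nonneg ∧
    Dom (⟨14 * (n : ℤ), 29 * n - κ, 16 * n, 15 * n, 16 * n + (10 * n - 12 * n + κ) - 15 * n, 10 * n - 12 * n + κ,
        14 * n + (10 * n - 12 * n + κ) - 15 * n, 12 * n⟩ : Params).S κ (κ - n) (15 * n) := by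
  refine ⟨⟨?_, ?_, ?_, ?_, ?_, ?_, ?_, ?_⟩, ?_⟩
  all_goals try (dsimp only; omega)
  rw [companion_S_rec]
  have c1 : ¬ κ < κ := lt_irrefl _
  have c2 : ¬ κ < 12 * n := by omega
  have c3 : ¬ κ < κ - n := by omega
  have c4 : ¬ κ < 13 * n := by omega
  have c5 : ¬ κ < 15 * n := by omega
  have c6 : ¬ κ < 14 * n := by omega
  have c7 : κ - n < κ ↔ 0 < (n : ℤ) := by constructor <;> intro h <;> omega
  have c8 : ¬ κ - n < 12 * n := by omega
  have c9 : ¬ κ - n < κ - n := lt_irrefl _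
  have c10 : ¬ κ - n < 13 * n := by omega
  have c11 : ¬ κ - n < 15 * n := by omega
  have c12 : ¬ κ - n < 14 * n := by omega
  have c13 : 15 * (n : ℤ) < κ ↔ 0 < (n : ℤ) := by constructor <;> intro h <;> omega
  have c14 : ¬ 15 * (n : ℤ) < 12 * n := by omega
  have c15 : 15 * (n : ℤ) < κ - n ↔ 0 < (n : ℤ) := by constructor <;> intro h <;> omega
  have c16 : ¬ 15 * (n : ℤ) < 13 * n := by omega
  have c17 : ¬ 15 * (n : ℤ) < 15 * n := lt_irrefl _
  have c18 : ¬ 15 * (n : ℤ) < 14 * n := by omega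
  refine ⟨?_, ?_, ?_⟩ <;>
    simp only [List.countP_cons, List.countP_nil, c1, c2, c3, c4, c5, c6, c7, c8, c9, c10, c11, c12, c13, c14, c15, c16,
      c17, c18, decide_false, Bool.false_eq_true, ite_false, add_zero, zero_add] <;>
    first | omega | (split_ifs <;> omega)

/-- The weight of (22) on the record ray at `κ = k ∈ [18n, 26n]`: `w_κ = (−1)^{43n+k}·C(k,12n)·C(8n,k−18n)·C(16n,k−13n)`. -/
theorem w22_rec (n k : ℕ) (h1 : 18 * n ≤ k) (h2 : k ≤ 26 * n) :
    w22 (pOf (n • (![8, 16, 10, 15, 12, 16, 18, 13] : Fin 8 → ℤ))) (qOf (n • (![8, 16, 10, 15, 12, 16, 18, 13] : Fin 8 → ℤ)))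
        (k : ℤ) =
      (-1) ^ (43 * n + k) * ((k.choose (12 * n) : ℕ) : ℤ) * (((8 * n).choose (k - 18 * n) : ℕ) : ℤ) *
        (((16 * n).choose (k - 13 * n) : ℕ) : ℤ) := by
  unfold w22
  rw [pOf_rec, qOf_rec]
  simp only [Matrix.cons_val]
  rw [show (18 * (n : ℤ) + 13 * n + 12 * n + k).toNat = 43 * n + k by
      rw [show (18 * (n : ℤ) + 13 * n + 12 * n + k) = ((43 * n + k : ℕ) : ℤ) by push_cast; ring, Int.toNat_natCast]]
  rw [show (12 * (n : ℤ)) = ((12 * n : ℕ) : ℤ) by push_cast; ring, zchoose_natCast _ _ (by omega),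
    show (k : ℤ) - 18 * n = ((k - 18 * n : ℕ) : ℤ) by omega, show (8 * (n : ℤ)) = ((8 * n : ℕ) : ℤ) by push_cast; ring,
    zchoose_natCast _ _ (by omega),
    show (k : ℤ) - 13 * n = ((k - 13 * n : ℕ) : ℤ) by omega, show (16 * (n : ℤ)) = ((16 * n : ℕ) : ℤ) by push_cast; ring,
    zchoose_natCast _ _ (by omega)]

/-! ### Kummer's carry, general form -/

/-- **Kummer's carry**: `d_κ ∣ d_{max(m, κ−m)}·C(κ,m)` for `m ≤ κ`.  (If `⌊log_p κ⌋ > ⌊log_p max(m,κ−m)⌋ =: ℓ` then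
`p^{ℓ+1} ≤ κ ≤ 2·max < p^{ℓ+2}` and the base-`p` addition `m + (κ−m)`, both summands `< p^{ℓ+1}`, carries out of the digit `ℓ`.) -/
theorem lcmUpto_dvd_lcmUpto_max_mul_choose {m κ : ℕ} (h : m ≤ κ) :
    Nat.lcmUpto κ ∣ Nat.lcmUpto (max m (κ - m)) * κ.choose m := by
  set M := max m (κ - m) with hM
  have hC : κ.choose m ≠ 0 := (Nat.choose_pos h).ne'
  rw [← Nat.factorization_le_iff_dvd (Nat.lcmUpto_ne_zero κ) (mul_ne_zero (Nat.lcmUpto_ne_zero M) hC)]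
  intro p
  rw [Nat.factorization_mul (Nat.lcmUpto_ne_zero M) hC, Finsupp.add_apply]
  by_cases hp : p.Prime
  · rw [Nat.factorization_lcmUpto κ hp, Nat.factorization_lcmUpto M hp]
    rcases Nat.eq_zero_or_pos κ with hκ | hκ
    · subst hκ; simp
    have hmM : m ≤ M := le_max_left _ _
    have hkM : κ - m ≤ M := le_max_right _ _
    have hM0 : 0 < M := by omega
    have hlt : κ < p ^ (Nat.log p M + 2) := by
      have h3 : M < p ^ (Nat.log p M + 1) := Nat.lt_pow_succ_log_self hp.one_lt M
      have h4 : p ^ (Nat.log p M + 1) * 2 ≤ p ^ (Nat.log p M + 2) := by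
        rw [pow_succ p (Nat.log p M + 1)]
        exact Nat.mul_le_mul_left _ hp.two_le
      omega
    have hlog : Nat.log p κ < Nat.log p M + 2 := (Nat.log_lt_iff_lt_pow hp.one_lt hκ.ne').2 hlt
    by_cases hle : Nat.log p κ ≤ Nat.log p M
    · omega
    · have heq : Nat.log p κ = Nat.log p M + 1 := by omega
      have hpow : p ^ (Nat.log p M + 1) ≤ κ := by rw [← heq]; exact Nat.pow_log_le_self p hκ.ne'
      have hcarry : 1 ≤ (κ.choose m).factorization p := by
        rw [Nat.factorization_choose hp h hlog]
        refine Finset.one_le_card.2 ⟨Nat.log p M + 1, ?_⟩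
        rw [Finset.mem_filter, Finset.mem_Ico]
        refine ⟨⟨by omega, by omega⟩, ?_⟩
        have hM' : M < p ^ (Nat.log p M + 1) := Nat.lt_pow_succ_log_self hp.one_lt M
        rw [Nat.mod_eq_of_lt (by omega), Nat.mod_eq_of_lt (by omega)]
        omega
      omega
  · simp [Nat.factorization_eq_zero_of_not_prime _ hp]

end Summit.KontsevichZagierPeriods.Zeta5Search.RecordRayDescentData
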